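import Mathlib
import Summits.HubbardSuperconductivity.HubbardSuperconductivity.Theses.BalabanIR

/-!
# Sketch — first lemmas for the crux ideas on `BalabanIR.BirBdGPhaseCoercivity`
(stmt-HubbardSuperconductivity-2081; planner crux-ideate round 1, ideator 3).
Nothing here is proved; every `theorem` is a SIGNATURE that must elaborate (sorried).
-/

noncomputable section

namespace Summit.HubbardSuperconductivity.HubbardSuperconductivity.Cruxes.BirBdGPhaseCoercivity.Sketch

open Matrix Finset
open scoped BigOperators ComplexOrder

/-! ## Generic matrix-analysis levers (Literature-grade, Hubbard-independent) -/

/-- Idea `nambu-metric-majorant`, first lemma (AM–GM / Fenchel majorant of the trace norm):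
for Hermitian `X` and positive definite `G`, `Σ_i |λ_i(X)| ≤ ½ (Re Tr (G X²) + Re Tr G⁻¹)`,
with equality iff `G = |X|⁻¹`. -/
theorem traceNorm_le_metric_majorant {n : Type*} [Fintype n] [DecidableEq n]
    (X G : Matrix n n ℂ) (hX : X.IsHermitian) (hG : G.PosDef) :
    ∑ i, |hX.eigenvalues i| ≤ ((G * (X * X)).trace.re + (G⁻¹).trace.re) / 2 := by
  sorry

/-- Idea `nambu-metric-majorant`, continuation (SDP dual certificate for the trace norm):
`B - X ⪰ 0`, `B + X ⪰ 0` ⇒ `Σ_i |λ_i(X)| ≤ Re Tr B`. -/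
theorem traceNorm_le_of_dual_certificate {n : Type*} [Fintype n] [DecidableEq n]
    (X B : Matrix n n ℂ) (hX : X.IsHermitian) (h₁ : (B - X).PosSemidef) (h₂ : (B + X).PosSemidef) :
    ∑ i, |hX.eigenvalues i| ≤ B.trace.re := by
  sorry

/-- Idea `dressed-nambu-metric`, first lemma (operator convexity of the inverse with an explicit
second-order remainder): for `K ≻ 0` and Hermitian `H` with `K + 2H ⪰ 0`,
`Tr (K+H)⁻¹ ≤ Tr K⁻¹ − Tr(K⁻¹ H K⁻¹) + 2 Tr(K⁻¹ H K⁻¹ H K⁻¹)` (from the twice-iterated resolvent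
identity and `(K+H)⁻¹ ⪯ 2K⁻¹`). This controls `Tr G_θ⁻¹` for the dressed metric `G_θ = K + δG(V_θ)`. -/
theorem trace_inv_add_le_second_order {n : Type*} [Fintype n] [DecidableEq n]
    (K H : Matrix n n ℂ) (hK : K.PosDef) (hH : H.IsHermitian) (h2 : (K + (2 : ℂ) • H).PosSemidef) :
    ((K + H)⁻¹).trace.re ≤
      (K⁻¹).trace.re - (K⁻¹ * H * K⁻¹).trace.re + 2 * (K⁻¹ * H * K⁻¹ * H * K⁻¹).trace.re := by
  sorry

/-- Idea `coin-diluted-pair-bonds`, first lemma (convexity of the trace norm along a segment of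
Hermitian matrices): `‖(1-t)X + tY‖₁ ≤ (1-t)‖X‖₁ + t‖Y‖₁`. -/
theorem traceNorm_convex_segment {n : Type*} [Fintype n] [DecidableEq n]
    (X Y : Matrix n n ℂ) (hX : X.IsHermitian) (hY : Y.IsHermitian) (t : ℝ) (ht0 : 0 ≤ t) (ht1 : t ≤ 1)
    (hZ : ((1 - t : ℝ) • X + (t : ℝ) • Y).IsHermitian) :
    ∑ i, |hZ.eigenvalues i| ≤ (1 - t) * ∑ i, |hX.eigenvalues i| + t * ∑ i, |hY.eigenvalues i| := by
  sorry

/-! ## The crux, pointwise in `(μ, Δ₁, Δ₂)` -/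

/-- The inner statement of `BirBdGPhaseCoercivity` at fixed `(μ, Δ₁, Δ₂)` with constant `c₀`
from side `L₀` on (verbatim copy of the route decl's body). -/
def CoerciveAt (μ Δ₁ Δ₂ c₀ : ℝ) (L₀ : ℕ) : Prop :=
  ∀ (L : ℕ) [NeZero L], L₀ ≤ L → let nnx : Literature.Probability.LatticeModels.TorusSite 2 L → Literature.Probability.LatticeModels.TorusSite 2 L → Prop := fun x y => y = x + ![1, 0] ∨ y = x + ![-1, 0]; let nny : Literature.Probability.LatticeModels.TorusSite 2 L → Literature.Probability.LatticeModels.TorusSite 2 L → Prop := fun x y => y = x + ![0, 1] ∨ y = x + ![0, -1]; let dg1 : Literature.Probability.LatticeModels.TorusSite 2 L → Literature.Probability.LatticeModels.TorusSite 2 L → Prop := fun x y => y = x + ![1, 1] ∨ y = x + ![-1, -1]; let dg2 : Literature.Probability.LatticeModels.TorusSite 2 L → Literature.Probability.LatticeModels.TorusSite 2 L → Prop := fun x y => y = x + ![1, -1] ∨ y = x + ![-1, 1]; let h : Matrix (Literature.Probability.LatticeModels.TorusSite 2 L) (Literature.Probability.LatticeModels.TorusSite 2 L) ℂ := fun x y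 => -(if nnx x y ∨ nny x y then (1 : ℂ) else 0) - (if x = y then (μ : ℂ) else 0); let D : (Literature.Probability.LatticeModels.TorusSite 2 L → ℝ) → Matrix (Literature.Probability.LatticeModels.TorusSite 2 L) (Literature.Probability.LatticeModels.TorusSite 2 L) ℂ := fun θ x y => ((Δ₁ : ℂ) * ((if nnx x y then (1 : ℂ) else 0) - (if nny x y then (1 : ℂ) else 0)) + Complex.I * (Δ₂ : ℂ) * ((if dg1 x y then (1 : ℂ) else 0) - (if dg2 x y then (1 : ℂ) else 0))) * (Complex.exp (Complex.I * (θ x : ℂ)) + Complex.exp (Complex.I * (θ y : ℂ))) / 2; let Hb : (Literature.Probability.LatticeModels.TorusSite 2 L → ℝ) → Matrix (Literature.Probability.LatticeModels.TorusSite 2 L ⊕ Literature.Probability.LatticeModels.TorusSite 2 L) (Literature.Probability.LatticeModels.TorusSite 2 L ⊕ Literature.Probability.LatticeModels.TorusSite 2 L) ℂ := fun θ => Matrix.fromBlocks h (D θ) (Matrix.conjTranspose (D θ)) (-h); ∀ θ : Literature.Probability.LatticeModels.TorusSite 2 L → ℝ, ∀ (hθ : (Hb θ).IsHermitian) (h0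 : (Hb (fun _ => 0)).IsHermitian), c₀ * ∑ x : Literature.Probability.LatticeModels.TorusSite 2 L, ∑ y : Literature.Probability.LatticeModels.TorusSite 2 L, (if nnx x y ∨ nny x y then (1 - Real.cos (θ x - θ y)) else 0) ≤ ∑ i, |h0.eigenvalues i| - ∑ i, |hθ.eigenvalues i|

/-- The crux is the `∀ (μ,Δ₁,Δ₂) ∃ c₀ L₀` closure of `CoerciveAt` (definitional). -/
theorem birBdGPhaseCoercivity_iff :
    Summit.HubbardSuperconductivity.HubbardSuperconductivity.Theses.BalabanIR.BirBdGPhaseCoercivity ↔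
      ∀ (μ Δ₁ Δ₂ : ℝ), μ ∈ Set.Ioo (-4:ℝ) 4 → Δ₁ ≠ 0 → Δ₂ ≠ 0 →
        ∃ c₀ : ℝ, 0 < c₀ ∧ ∃ L₀ : ℕ, CoerciveAt μ Δ₁ Δ₂ c₀ L₀ :=
  Iff.rfl

/-! ## Idea `nambu-metric-majorant`: the one-loop symbol inequality (★) -/

/-- Momentum `2π k_i / L` of a dual-torus point. -/
def mom {L : ℕ} (k : Literature.Probability.LatticeModels.TorusSite 2 L) (i : Fin 2) : ℝ :=
  2 * Real.pi * ((k i).val : ℝ) / L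

/-- Band energy `ξ_k = -2cos k₁ - 2cos k₂ - μ`. -/
def xi (μ : ℝ) {L : ℕ} (k : Literature.Probability.LatticeModels.TorusSite 2 L) : ℝ :=
  -2 * Real.cos (mom k 0) - 2 * Real.cos (mom k 1) - μ

/-- Gap function `Δ_k = 2Δ₁(cos k₁ - cos k₂) - 4iΔ₂ sin k₁ sin k₂` (the symbol of `D(0)`). -/
def gap (Δ₁ Δ₂ : ℝ) {L : ℕ} (k : Literature.Probability.LatticeModels.TorusSite 2 L) : ℂ :=
  (2 * Δ₁ * (Real.cos (mom k 0) - Real.cos (mom k 1)) : ℝ) -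
    4 * Complex.I * (Δ₂ * Real.sin (mom k 0) * Real.sin (mom k 1) : ℝ)

/-- Quasiparticle energy `E_k = √(ξ_k² + |Δ_k|²)`. -/
def qpE (μ Δ₁ Δ₂ : ℝ) {L : ℕ} (k : Literature.Probability.LatticeModels.TorusSite 2 L) : ℝ :=
  Real.sqrt (xi μ k ^ 2 + ‖gap Δ₁ Δ₂ k‖ ^ 2)

/-- The frozen-metric kernel `𝒦(k,k') = |Δ_k|²/E_k + |Δ_k'|²/E_k' − ¼|Δ_k+Δ_k'|²(1/E_k+1/E_k')`. -/
def kern (μ Δ₁ Δ₂ : ℝ) {L : ℕ} (k k' : Literature.Probability.LatticeModels.TorusSite 2 L) : ℝ :=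
  ‖gap Δ₁ Δ₂ k‖ ^ 2 / qpE μ Δ₁ Δ₂ k + ‖gap Δ₁ Δ₂ k'‖ ^ 2 / qpE μ Δ₁ Δ₂ k' -
    ‖gap Δ₁ Δ₂ k + gap Δ₁ Δ₂ k'‖ ^ 2 * (1 / qpE μ Δ₁ Δ₂ k + 1 / qpE μ Δ₁ Δ₂ k') / 4

/-- (★) ONE-LOOP SYMBOL INEQUALITY: `𝒢_L(q) := Σ_k 𝒦(k,k+q) ≥ 2 c₀ L² ε(q)` for every `q ≠ 0`,
`ε(q) = 4 − 2cos q₁ − 2cos q₂`, from side `L₀` on. A finite-dimensional (two momenta) inequality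
about explicit trigonometric sums; no `θ`, no eigenvalues. -/
def FrozenMetricSymbolIneq (μ Δ₁ Δ₂ c₀ : ℝ) (L₀ : ℕ) : Prop :=
  ∀ (L : ℕ) [NeZero L], L₀ ≤ L → ∀ q : Literature.Probability.LatticeModels.TorusSite 2 L, q ≠ 0 →
    2 * c₀ * (L : ℝ) ^ 2 * (4 - 2 * Real.cos (mom q 0) - 2 * Real.cos (mom q 1)) ≤
      ∑ k : Literature.Probability.LatticeModels.TorusSite 2 L, kern μ Δ₁ Δ₂ k (k + q)

/-- Idea `nambu-metric-majorant`, reduction lemma: the frozen-metric majorant with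
`G = |Hb(0)|⁻¹ = diag(K,K)`, `K = 𝔉 diag(1/E_k) 𝔉ᴴ`, turns (★) into the crux at `(μ,Δ₁,Δ₂)` with
the SAME constant: `S(0) − S(θ) ≥ ½ Σ_q |ê(q)|² 𝒢_L(q)` and `R(θ) = L² Σ_q |ê(q)|² ε(q)`,
`ê` = Fourier coefficients of `e^{iθ}`, `Σ_q |ê(q)|² = 1`. Needs the full gap `E_k > 0`
(automatic for `Δ₁Δ₂ ≠ 0`, `μ ∈ (−4,4)`). -/
theorem coerciveAt_of_frozenMetricSymbolIneq (μ Δ₁ Δ₂ c₀ : ℝ) (L₀ : ℕ)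
    (hμ : μ ∈ Set.Ioo (-4:ℝ) 4) (h₁ : Δ₁ ≠ 0) (h₂ : Δ₂ ≠ 0)
    (h : FrozenMetricSymbolIneq μ Δ₁ Δ₂ c₀ L₀) : CoerciveAt μ Δ₁ Δ₂ c₀ L₀ := by
  sorry

end Summit.HubbardSuperconductivity.HubbardSuperconductivity.Cruxes.BirBdGPhaseCoercivity.Sketch

end
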